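import Mathlib
import Summits.Ventures.PercRepro2.PointSplitSourceLeaf

/-!
# The point-split form at a pendant split point: `(PS) = q·(PS1) − 2q²·S` in general
(blind cell PercRepro2, night-3 g27, 2026-08-29; `proofs/NIGHT3-CERT.md` §36.11)

Let `w` be a leaf of the graph, joined to `u` by the single edge `e` of weight `q = p e`, `w ≠ s`,
and let `F, G` be cluster functionals that ignore `w` (`F (S \ {w}) = F S`).  Then, with `X = Y = ∅`,
the cross form of `PointSplitBHK` at the split point `w` is

`M(1_{w ∈ C_s}, 1_{w ∉ C_s}) = q · M₀(1_{u ∈ C_s}, 1) − 2 q² · S₀(1_{u ∈ C_s})`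

(`mixedForm_pendant_split`), where `M₀` is the point-split form of `PointSplitBHKOne` and `S₀` the
`u`-class BHK form `bhkFormW`, both at the weights `p[e := 0]` (the graph without the leaf).  At
first order in `q`, (PS) at a pendant split point IS (PS1) at its neighbour: every failure of (PS1)
is a failure of (PS) with a light leaf — `K2nLeafPointSplit` is the instance on `K_{2,21}`.
Ingredients: the leaf never mediates (`conn_update_leafEdge_iff`: connectivity to any `x ≠ w` does
not depend on the state of `e`), `w ∈ C_s ⟺ e open ∧ u ∈ C_s` (`conn_pendant_iff`), and the pinning
identities of `Independence` / `PointSplitSourceLeaf`.  Own work; standard axioms.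
-/

namespace Summit.Ventures.PercRepro2

namespace CovForm

namespace PointSplit

variable {V : Type*} {E : Type*} [Fintype E] [DecidableEq E]
  {R : Type*} [Field R] [LinearOrder R] [IsStrictOrderedRing R]

/-! ## Connectivity across a pendant leaf -/

omit [Fintype E] [DecidableEq E] in
/-- Changing the state of the leaf edge does not change the connectivity of `s` to any `x ≠ w`. -/
lemma conn_of_conn_update_leafEdge {ends : E → Sym2 V} {e : E} {u w : V} (huw : u ≠ w)
    (hends : ends e = s(u, w)) (hleaf : ∀ f, w ∈ ends f → f = e) {ω ω' : Config E}
    (hoff : ∀ f, f ≠ e → ω' f = ω f) {s x : V} (hs : s ≠ w) (hx : x ≠ w)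
    (h : Conn ends ω' s x) : Conn ends ω s x := by
  let S : Set V := {y | (y ≠ w ∧ Conn ends ω s y) ∨ (y = w ∧ Conn ends ω s u)}
  have hS : ∀ y ∈ S, ∀ z, (openGraph ends ω').Adj y z → z ∈ S := by
    intro y hy z hyz
    rw [openGraph_adj] at hyz
    obtain ⟨-, f, hf, hfe⟩ := hyz
    by_cases hfe' : f = e
    · subst hfe'
      rw [hends, Sym2.eq_iff] at hfe
      rcases hfe with ⟨rfl, rfl⟩ | ⟨rfl, rfl⟩
      · -- `y = u`, `z = w`
        rcases hy with ⟨-, hc⟩ | ⟨hyw, -⟩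
        · exact Or.inr ⟨rfl, hc⟩
        · exact absurd hyw huw
      · -- `y = w`, `z = u`
        rcases hy with ⟨hyw, -⟩ | ⟨-, hc⟩
        · exact absurd rfl hyw
        · exact Or.inl ⟨huw, hc⟩
    · have hz : z ≠ w := by
        rintro rfl
        exact hfe' (hleaf f (by rw [hfe]; exact Sym2.mem_mk_right _ _))
      have hy' : y ≠ w := by
        rintro rfl
        exact hfe' (hleaf f (by rw [hfe]; exact Sym2.mem_mk_left _ _))
      rcases hy with ⟨-, hc⟩ | ⟨hyw, -⟩
      · exact Or.inl ⟨hz, conn_trans hc (conn_of_openAdj ⟨f, by rw [← hoff f hfe']; exact hf, hfe⟩)⟩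
      · exact absurd hyw hy'
  have hx' : x ∈ S := mem_of_conn_of_closed hS (Or.inl ⟨hs, conn_refl _ _ _⟩) h
  rcases hx' with ⟨-, hc⟩ | ⟨hxw, -⟩
  · exact hc
  · exact absurd hxw hx

omit [Fintype E] in
/-- Connectivity of `s` to `x ≠ w` is the same under `ω` and `ω[e := b]`. -/
lemma conn_update_leafEdge_iff {ends : E → Sym2 V} {e : E} {u w : V} (huw : u ≠ w)
    (hends : ends e = s(u, w)) (hleaf : ∀ f, w ∈ ends f → f = e) (ω : Config E) (b : Bool)
    {s x : V} (hs : s ≠ w) (hx : x ≠ w) :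
    Conn ends (Function.update ω e b) s x ↔ Conn ends ω s x := by
  constructor
  · exact conn_of_conn_update_leafEdge huw hends hleaf
      (fun f hf => Function.update_of_ne hf b ω) hs hx
  · exact conn_of_conn_update_leafEdge huw hends hleaf
      (fun f hf => (Function.update_of_ne hf b ω).symm) hs hx

omit [Fintype E] [DecidableEq E] in
/-- `w ∈ C_s ⟺ e open ∧ u ∈ C_s`. -/
lemma conn_pendant_iff {ends : E → Sym2 V} {e : E} {u w : V} (huw : u ≠ w)
    (hends : ends e = s(u, w)) (hleaf : ∀ f, w ∈ ends f → f = e) (ω : Config E) {s : V}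
    (hs : s ≠ w) :
    Conn ends ω s w ↔ (ω e = true ∧ Conn ends ω s u) := by
  constructor
  · intro h
    -- the closure set of `conn_of_conn_update_leafEdge` with `ω' = ω`
    let S : Set V := {y | (y ≠ w ∧ Conn ends ω s y) ∨ (y = w ∧ (ω e = true ∧ Conn ends ω s u))}
    have hS : ∀ y ∈ S, ∀ z, (openGraph ends ω).Adj y z → z ∈ S := by
      intro y hy z hyz
      rw [openGraph_adj] at hyz
      obtain ⟨-, f, hf, hfe⟩ := hyz
      by_cases hfe' : f = e
      · subst hfe'
        rw [hends, Sym2.eq_iff] at hfe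
        rcases hfe with ⟨rfl, rfl⟩ | ⟨rfl, rfl⟩
        · rcases hy with ⟨-, hc⟩ | ⟨hyw, -⟩
          · exact Or.inr ⟨rfl, hf, hc⟩
          · exact absurd hyw huw
        · rcases hy with ⟨hyw, -⟩ | ⟨-, -, hc⟩
          · exact absurd rfl hyw
          · exact Or.inl ⟨huw, hc⟩
      · have hz : z ≠ w := by
          rintro rfl
          exact hfe' (hleaf f (by rw [hfe]; exact Sym2.mem_mk_right _ _))
        have hy' : y ≠ w := by
          rintro rfl
          exact hfe' (hleaf f (by rw [hfe]; exact Sym2.mem_mk_left _ _))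
        rcases hy with ⟨-, hc⟩ | ⟨hyw, -⟩
        · exact Or.inl ⟨hz, conn_trans hc (conn_of_openAdj ⟨f, hf, hfe⟩)⟩
        · exact absurd hyw hy'
    have hw : w ∈ S := mem_of_conn_of_closed hS (Or.inl ⟨hs, conn_refl _ _ _⟩) h
    rcases hw with ⟨hww, -⟩ | ⟨-, hb, hc⟩
    · exact absurd rfl hww
    · exact ⟨hb, hc⟩
  · rintro ⟨hb, hc⟩
    exact conn_trans hc (conn_of_openAdj ⟨e, hb, hends⟩)

/-! ## Functionals that ignore the leaf, and the pinned expectations -/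

omit [Fintype E] [DecidableEq E] [Field R] [LinearOrder R] [IsStrictOrderedRing R] in
/-- `F` ignores the vertex `w`. -/
def IgnoresVertex (w : V) (F : Set V → R) : Prop := ∀ S, F (S \ {w}) = F S

omit [Fintype E] in
/-- With the leaf edge closed, the cluster of `s` is the cluster without `w`. -/
lemma cluster_update_false_eq {ends : E → Sym2 V} {e : E} {u w : V} (huw : u ≠ w)
    (hends : ends e = s(u, w)) (hleaf : ∀ f, w ∈ ends f → f = e) (ω : Config E) {s : V}
    (hs : s ≠ w) :
    cluster ends (Function.update ω e false) s = cluster ends ω s \ {w} := by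
  ext x
  simp only [mem_cluster, Set.mem_sdiff, Set.mem_singleton_iff]
  by_cases hx : x = w
  · subst hx
    constructor
    · intro h
      have := ((conn_pendant_iff huw hends hleaf _ hs).1 h).1
      simp at this
    · rintro ⟨-, h⟩
      exact absurd rfl h
  · rw [conn_update_leafEdge_iff huw hends hleaf ω false hs hx]
    exact ⟨fun h => ⟨h, hx⟩, fun h => h.1⟩

omit [Fintype E] [Field R] [LinearOrder R] [IsStrictOrderedRing R] in
/-- A functional ignoring `w` does not see the leaf edge. -/
lemma ignores_cluster_eq {ends : E → Sym2 V} {e : E} {u w : V} (huw : u ≠ w)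
    (hends : ends e = s(u, w)) (hleaf : ∀ f, w ∈ ends f → f = e) {F : Set V → R}
    (hF : IgnoresVertex w F) (ω : Config E) {s : V} (hs : s ≠ w) :
    F (cluster ends ω s) = F (cluster ends (Function.update ω e false) s) := by
  rw [cluster_update_false_eq huw hends hleaf ω hs, hF]

omit [Fintype E] [DecidableEq E] [LinearOrder R] [IsStrictOrderedRing R] in
/-- The point weight at the pendant leaf: `1_{w ∈ C_s} = 1_{u ∈ C_s} · 1_{e open}`. -/
lemma indicator_conn_pendant {ends : E → Sym2 V} {e : E} {u w : V} (huw : u ≠ w)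
    (hends : ends e = s(u, w)) (hleaf : ∀ f, w ∈ ends f → f = e) (ω : Config E) {s : V}
    (hs : s ≠ w) :
    (connEvent ends s w).indicator (1 : Config E → R) ω =
      (connEvent ends s u).indicator (1 : Config E → R) ω * (if ω e = true then 1 else 0) := by
  by_cases h : Conn ends ω s w
  · rw [Set.indicator_of_mem (show ω ∈ connEvent ends s w from h)]
    obtain ⟨hb, hc⟩ := (conn_pendant_iff huw hends hleaf ω hs).1 h
    rw [Set.indicator_of_mem (show ω ∈ connEvent ends s u from hc)]
    simp [hb]
  · rw [Set.indicator_of_notMem (show ω ∉ connEvent ends s w from h)]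
    rw [conn_pendant_iff huw hends hleaf ω hs] at h
    by_cases hb : ω e = true
    · have hc : ω ∉ connEvent ends s u := fun hc => h ⟨hb, hc⟩
      rw [Set.indicator_of_notMem hc]
      simp
    · simp [hb]

omit [Fintype E] [DecidableEq E] [LinearOrder R] [IsStrictOrderedRing R] in
/-- The complementary point weight at the pendant leaf. -/
lemma indicator_conn_pendant_compl {ends : E → Sym2 V} {e : E} {u w : V} (huw : u ≠ w)
    (hends : ends e = s(u, w)) (hleaf : ∀ f, w ∈ ends f → f = e) (ω : Config E) {s : V}
    (hs : s ≠ w) :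
    ((connEvent ends s w)ᶜ).indicator (1 : Config E → R) ω =
      1 - (connEvent ends s u).indicator (1 : Config E → R) ω * (if ω e = true then 1 else 0) := by
  rw [← indicator_conn_pendant huw hends hleaf ω hs]
  by_cases h : ω ∈ connEvent ends s w
  · rw [Set.indicator_of_notMem (show ω ∉ (connEvent ends s w)ᶜ from fun h' => h' h),
      Set.indicator_of_mem h]
    simp
  · rw [Set.indicator_of_mem (show ω ∈ (connEvent ends s w)ᶜ from h), Set.indicator_of_notMem h]
    simp

omit [LinearOrder R] [IsStrictOrderedRing R] in
/-- An observable that does not see `e` has the same expectation under `p` and `p[e := 0]`. -/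
lemma expect_eq_update_zero_of_invariant (p : E → R) (e : E) {ψ : Config E → R}
    (hψ : ∀ ω, ψ (Function.update ω e false) = ψ ω) :
    expect p ψ = expect (Function.update p e 0) ψ := by
  rw [expect_update_zero]
  exact (congrArg _ (funext hψ)).symm

omit [LinearOrder R] [IsStrictOrderedRing R] in
/-- `E_p[ψ · 1_{e open}] = p_e · E_{p[e := 0]}[ψ]` for an observable that does not see `e`. -/
lemma expect_mul_open_eq_of_invariant (p : E → R) (e : E) {ψ : Config E → R}
    (hψ : ∀ ω, ψ (Function.update ω e false) = ψ ω) :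
    expect p (fun ω => ψ ω * (if ω e = true then 1 else 0)) =
      p e * expect (Function.update p e 0) ψ := by
  rw [expect_mul_open_eq, expect_update_one, expect_update_zero]
  congr 1
  refine congrArg _ (funext fun ω => ?_)
  rw [← hψ (Function.update ω e true), Function.update_idem, hψ]

omit [LinearOrder R] [IsStrictOrderedRing R] in
/-- Under `p[e := 0]` an observable may be evaluated with `e` closed. -/
lemma expect_update_zero_congr_closed (p : E → R) (e : E) (f : Config E → R) :
    expect (Function.update p e 0) f =
      expect (Function.update p e 0) (fun ω => f (Function.update ω e false)) := by
  rw [expect_update_zero, expect_update_zero]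
  refine congrArg _ (funext fun ω => ?_)
  rw [Function.update_idem]

/-! ## The four expectations at the pendant split point -/

variable [DecidableEq V]

omit [LinearOrder R] [IsStrictOrderedRing R] [DecidableEq V] in
/-- `wExpect_p[F' · 1_{w ∈ C}] = p_e · wExpect_{p[e:=0]}[F' · 1_{u ∈ C}]` for `F'` ignoring `w`. -/
lemma wExpect_pendant_w (p : E → R) {ends : E → Sym2 V} {e : E} {u w : V} (huw : u ≠ w)
    (hends : ends e = s(u, w)) (hleaf : ∀ f, w ∈ ends f → f = e) {s : V} (hs : s ≠ w)
    {F' : Set V → R} (hF' : IgnoresVertex w F') :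
    wExpect p ends s ∅ F' ((connEvent ends s w).indicator 1) =
      p e * wExpect (Function.update p e 0) ends s ∅ F' ((connEvent ends s u).indicator 1) := by
  rw [wExpect_empty, wExpect_empty]
  have hpt : ∀ ω : Config E, F' (cluster ends ω s) * (connEvent ends s w).indicator (1 : Config E → R) ω =
      (F' (cluster ends (Function.update ω e false) s) *
        (connEvent ends s u).indicator (1 : Config E → R) (Function.update ω e false)) *
        (if ω e = true then 1 else 0) := by
    intro ω
    rw [indicator_conn_pendant huw hends hleaf ω hs, ignores_cluster_eq huw hends hleaf hF' ω hs]
    have : (connEvent ends s u).indicator (1 : Config E → R) (Function.update ω e false) =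
        (connEvent ends s u).indicator (1 : Config E → R) ω := by
      by_cases hu : Conn ends ω s u
      · rw [Set.indicator_of_mem (show ω ∈ connEvent ends s u from hu),
          Set.indicator_of_mem (show Function.update ω e false ∈ connEvent ends s u from
            (conn_update_leafEdge_iff huw hends hleaf ω false hs huw).2 hu)]
        rfl
      · rw [Set.indicator_of_notMem (show ω ∉ connEvent ends s u from hu),
          Set.indicator_of_notMem (show Function.update ω e false ∉ connEvent ends s u from
            fun h => hu ((conn_update_leafEdge_iff huw hends hleaf ω false hs huw).1 h))]
    rw [this]
    ring
  simp_rw [hpt]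
  rw [expect_mul_open_eq_of_invariant p e (ψ := fun ω => F' (cluster ends (Function.update ω e false) s) *
    (connEvent ends s u).indicator (1 : Config E → R) (Function.update ω e false))
    (fun ω => by simp only [Function.update_idem]),
    ← expect_update_zero_congr_closed p e
      (fun ω => F' (cluster ends ω s) * (connEvent ends s u).indicator (1 : Config E → R) ω)]

omit [LinearOrder R] [IsStrictOrderedRing R] [DecidableEq V] in
/-- `wExpect_p[F' · 1_{w ∉ C}] = wExpect_{p[e:=0]}[F'] − p_e · wExpect_{p[e:=0]}[F' · 1_{u ∈ C}]`. -/
lemma wExpect_pendant_wc (p : E → R) {ends : E → Sym2 V} {e : E} {u w : V} (huw : u ≠ w)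
    (hends : ends e = s(u, w)) (hleaf : ∀ f, w ∈ ends f → f = e) {s : V} (hs : s ≠ w)
    {F' : Set V → R} (hF' : IgnoresVertex w F') :
    wExpect p ends s ∅ F' (((connEvent ends s w)ᶜ).indicator 1) =
      wExpect (Function.update p e 0) ends s ∅ F' (fun _ => 1) -
        p e * wExpect (Function.update p e 0) ends s ∅ F' ((connEvent ends s u).indicator 1) := by
  rw [← wExpect_pendant_w p huw hends hleaf hs hF']
  rw [wExpect_empty, wExpect_empty, wExpect_empty]
  have hsplit : (fun ω => F' (cluster ends ω s) * ((connEvent ends s w)ᶜ).indicator (1 : Config E → R) ω) =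
      (fun ω => F' (cluster ends ω s) * 1 - F' (cluster ends ω s) *
        (connEvent ends s w).indicator (1 : Config E → R) ω) := by
    funext ω
    rw [indicator_conn_pendant_compl huw hends hleaf ω hs, indicator_conn_pendant huw hends hleaf ω hs]
    ring
  rw [hsplit, show (fun ω => F' (cluster ends ω s) * (1 : R) - F' (cluster ends ω s) *
      (connEvent ends s w).indicator (1 : Config E → R) ω) =
      (fun ω => F' (cluster ends ω s) * (1 : R)) - (fun ω => F' (cluster ends ω s) *
      (connEvent ends s w).indicator (1 : Config E → R) ω) from rfl, expect_sub]
  congr 1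
  have hinv : ∀ ω, (fun ω => F' (cluster ends (Function.update ω e false) s) * (1 : R))
      (Function.update ω e false) = (fun ω => F' (cluster ends (Function.update ω e false) s) * (1 : R)) ω := by
    intro ω
    simp only [Function.update_idem]
  have h1 : (fun ω => F' (cluster ends ω s) * (1 : R)) =
      fun ω => F' (cluster ends (Function.update ω e false) s) * 1 := by
    funext ω
    rw [ignores_cluster_eq huw hends hleaf hF' ω hs]
  rw [h1, expect_eq_update_zero_of_invariant p e hinv,
    ← expect_update_zero_congr_closed p e (fun ω => F' (cluster ends ω s) * 1)]

omit [Fintype E] [DecidableEq E] [LinearOrder R] [IsStrictOrderedRing R] [DecidableEq V] in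
/-- Products of functionals ignoring `w` ignore `w`. -/
lemma IgnoresVertex.mul {w : V} {F G : Set V → R} (hF : IgnoresVertex w F) (hG : IgnoresVertex w G) :
    IgnoresVertex w (fun S => F S * G S) := fun S => by simp only [hF S, hG S]

omit [Fintype E] [DecidableEq E] [LinearOrder R] [IsStrictOrderedRing R] [DecidableEq V] in
/-- The constant functional ignores `w`. -/
lemma IgnoresVertex.one (w : V) : IgnoresVertex w (fun _ : Set V => (1 : R)) := fun _ => rfl

omit [LinearOrder R] [IsStrictOrderedRing R] in
/-- **The pendant split point**: with `X = Y = ∅`, the cross form at a pendant leaf `w` at `u` is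
`q · M₀(1_{u ∈ C_s}, 1) − 2 q² · S₀(1_{u ∈ C_s})`, `q = p e`, `M₀ / S₀` the point-split and BHK
forms at `p[e := 0]`. -/
theorem mixedForm_pendant_split (p : E → R) {ends : E → Sym2 V} {e : E} {u w : V} (huw : u ≠ w)
    (hends : ends e = s(u, w)) (hleaf : ∀ f, w ∈ ends f → f = e) {s : V} (hs : s ≠ w)
    {F G : Set V → R} (hF : IgnoresVertex w F) (hG : IgnoresVertex w G) :
    mixedFormW p ends s ∅ ∅ F G ((connEvent ends s w).indicator 1)
        (((connEvent ends s w)ᶜ).indicator 1) =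
      p e * mixedFormW (Function.update p e 0) ends s ∅ ∅ F G
          ((connEvent ends s u).indicator 1) (fun _ => 1) -
        2 * (p e) ^ 2 * bhkFormW (Function.update p e 0) ends s ∅ ∅ F G
          ((connEvent ends s u).indicator 1) := by
  have hFG := hF.mul hG
  have h1 := IgnoresVertex.one (R := R) w
  unfold mixedFormW bhkFormW
  simp only [Finset.inter_self, Finset.union_self]
  rw [wExpect_pendant_w p huw hends hleaf hs hFG, wExpect_pendant_wc p huw hends hleaf hs h1,
    wExpect_pendant_wc p huw hends hleaf hs hFG, wExpect_pendant_w p huw hends hleaf hs h1,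
    wExpect_pendant_w p huw hends hleaf hs hF, wExpect_pendant_wc p huw hends hleaf hs hG,
    wExpect_pendant_wc p huw hends hleaf hs hF, wExpect_pendant_w p huw hends hleaf hs hG]
  have hone : wExpect (Function.update p e 0) ends s ∅ (fun _ => (1 : R)) (fun _ => 1) = 1 := by
    rw [wExpect_empty]
    simp [expect_const]
  rw [hone]
  ring

end PointSplit

end CovForm

end Summit.Ventures.PercRepro2
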